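import Summits.HubbardSuperconductivity.HubbardSuperconductivity.Theorems.AnisotropyChordTransferFibre3BCOuterCross

/-!
# Route `AnisotropyChord` / H0 rotor rung: PartN41-B §6 — the `B_C` OUTER MAJORANT, part 2: assembly (content version, `κ̂′`)

Theory-1 g22's PartN41-B §6 `BCOuterBound` (ported …Fibre3N1Row) with `κ̂′ = kapHat + 2·aPar·cS/V` for `κ̂`:
per momentum `k` off the pair block (`k′ = k + K₁`), with `φ̂ = μ + ρ`, `F₂ = c + t`:
`Σ_e bcSummand − [R(c + c′) + M c′] = (X − R)(c + c′ + t + t′) + R(t + t′) + (S − M)(c′ + t′) + M t′`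
(`X = Σ_e Re(conj φ̂_e(k) φ̂_e(k′))`, `S = Σ_e |φ̂_e(k)|²`), `|X − R| ≤ D₁` (★ `cross_sum_diff_le`, from …BCOuterCross and
`Σ_e‖1−z_e‖² = 2E`), `|R| ≤ Rabs`, `|S − M| ≤ Y + P₂` (…PC0Outer): ★ `bc_term_bound`, ★ `bc_outer_bound` — `BCOuterBound`
with `κ̂′`, in the regime (`L ≥ 5`, `0 ≤ Δ < 1`, ground state, `4(M₂+2) ≤ L`, `m₀ > 0`).
Prover seat `hubbard-h0-rotor-p1` g26 (route lead); helper for stmt-HubbardSuperconductivity-23918 (`--supports`, helper class).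
WHAT THIS IS NOT: nothing here proves superconductivity in the Hubbard model; a termwise majorant of ONE row of ONE conditional
reduction.  Tree imports only; no new definitions; no sorry, no axioms.
-/

set_option linter.dupNamespace false
set_option autoImplicit false

noncomputable section

open scoped BigOperators

namespace Summit.HubbardSuperconductivity.HubbardSuperconductivity.Theorems.AnisotropyChord.Transfer.Fibre3

variable (L : ℕ) [NeZero L]

namespace OuterMaj

/-! ## The per-momentum and summed `B_C` bounds -/

omit [NeZero L] in
/-- the abstract assembly inequality. [folklore] -/
theorem bc_assembly {x z r tt s z' M t' D Z Rb TT YP Z' K' : ℝ}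
    (hx : |x| ≤ D) (hz : |z| ≤ Z) (hr : |r| ≤ Rb) (htt : |tt| ≤ TT) (hs : |s| ≤ YP) (hz' : |z'| ≤ Z')
    (hM : 0 ≤ M) (ht' : |t'| ≤ K') :
    |x * z + r * tt + s * z' + M * t'| ≤ Rb * TT + D * Z + M * K' + YP * Z' := by
  have hD : 0 ≤ D := (abs_nonneg _).trans hx
  have hRb : 0 ≤ Rb := (abs_nonneg _).trans hr
  have hYP : 0 ≤ YP := (abs_nonneg _).trans hs
  calc |x * z + r * tt + s * z' + M * t'|
      ≤ |x * z| + |r * tt| + |s * z'| + |M * t'| := by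
        have h1 := abs_add_le (x * z + r * tt + s * z') (M * t')
        have h2 := abs_add_le (x * z + r * tt) (s * z')
        have h3 := abs_add_le (x * z) (r * tt)
        linarith
    _ = |x| * |z| + |r| * |tt| + |s| * |z'| + M * |t'| := by
        rw [abs_mul, abs_mul, abs_mul, abs_mul, abs_of_nonneg hM]
    _ ≤ D * Z + Rb * TT + YP * Z' + M * K' := by
        have e1 := mul_le_mul hx hz (abs_nonneg _) hD
        have e2 := mul_le_mul hr htt (abs_nonneg _) hRb
        have e3 := mul_le_mul hs hz' (abs_nonneg _) hYP
        have e4 := mul_le_mul_of_nonneg_left ht' hM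
        linarith
    _ = Rb * TT + D * Z + M * K' + YP * Z' := by ring

/-- `|Σ_e Re(conj φ̂_e(k) φ̂_e(k′)) − R(k)| ≤ D₁(k)` (with `κ̂′`). [folklore] -/
theorem cross_sum_diff_le (hL : 5 ≤ L) {Δ : ℝ} (hΔ0 : 0 ≤ Δ) (hΔ1 : Δ < 1) {lam2 : ℝ} {f : Tor L → ℝ}
    (hf : IsGroundTwoMagnon L Δ lam2 f) (M2 : ℕ) (hM : 4 * (M2 + 2) ≤ L) {m0 : ℝ} (hm0 : 0 < m0)
    (k : Tor L) (hk : k ≠ 0) (hk' : k + K1 L ≠ 0)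
    (hfloor : 1 - Real.cos (2 * Real.pi * (M2 + 1) / L) ≤ epsT L k)
    (hfloor' : 1 - Real.cos (2 * Real.pi * (M2 + 1) / L) ≤ epsT L (k + K1 L)) :
    let κ := kapHat L Δ lam2 f M2 + 2 * aPar L Δ f * cS L Δ lam2 f / (L : ℝ) ^ 2
    let g0 := gres L lam2 k
    let g1 := gres L lam2 (k + K1 L)
    let β0 := betaK L Δ lam2 f k
    let β1 := betaK L Δ lam2 f (k + K1 L)
    let q := qPar L Δ f
    let τ := tauBar L Δ lam2 f
    |((starRingEnd ℂ) (phiHat L f (ex L) k) * phiHat L f (ex L) (k + K1 L)).re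
        + ((starRingEnd ℂ) (phiHat L f (-ex L) k) * phiHat L f (-ex L) (k + K1 L)).re
        + ((starRingEnd ℂ) (phiHat L f (ey L) k) * phiHat L f (ey L) (k + K1 L)).re
        + ((starRingEnd ℂ) (phiHat L f (-ey L) k) * phiHat L f (-ey L) (k + K1 L)).re - RK L Δ lam2 f k|
      ≤ κ / 2 * β0 * g1 * (EK L k + EK L (k + K1 L)) + τ * (β0 ^ 2 * EK L k / (2 * m0) + m0)
        + κ / 2 * β1 * g0 * (EK L k + EK L (k + K1 L)) + τ * (β1 ^ 2 * EK L (k + K1 L) / (2 * m0) + m0)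
        + 4 * q * τ + τ ^ 2 + (4 * q * κ + 2 * τ * κ) * (g0 + g1)
        + κ ^ 2 / 4 * g0 * g1 * (EK L k + EK L (k + K1 L)) := by
  dsimp only
  set κ' := kapHat L Δ lam2 f M2 + 2 * aPar L Δ f * cS L Δ lam2 f / (L : ℝ) ^ 2 with hκ
  have hR := rKIdentity_holds L Δ lam2 f k
  rw [nnList_map_sum] at hR
  have hE := phaseDefectSum_holds L k
  have hE' := phaseDefectSum_holds L (k + K1 L)
  rw [nnList_map_sum] at hE hE'
  have hm1 : ex L ∈ nnList L := by unfold nnList ex; simp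
  have hm2 : -ex L ∈ nnList L := by rw [← neg_ex]; unfold nnList; simp
  have hm3 : ey L ∈ nnList L := by unfold nnList ey; simp
  have hm4 : -ey L ∈ nnList L := by rw [← neg_ey]; unfold nnList; simp
  have d1 := dir_cross_diff_le L hL hΔ0 hΔ1 hf M2 hM hm0 k hk hk' hfloor hfloor' (ex L) hm1
  have d2 := dir_cross_diff_le L hL hΔ0 hΔ1 hf M2 hM hm0 k hk hk' hfloor hfloor' (-ex L) hm2
  have d3 := dir_cross_diff_le L hL hΔ0 hΔ1 hf M2 hM hm0 k hk hk' hfloor hfloor' (ey L) hm3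
  have d4 := dir_cross_diff_le L hL hΔ0 hΔ1 hf M2 hM hm0 k hk hk' hfloor hfloor' (-ey L) hm4
  dsimp only at d1 d2 d3 d4
  rw [← hκ] at d1 d2 d3 d4
  rw [← hR]
  obtain ⟨l1, r1⟩ := abs_le.1 d1
  obtain ⟨l2, r2⟩ := abs_le.1 d2
  obtain ⟨l3, r3⟩ := abs_le.1 d3
  obtain ⟨l4, r4⟩ := abs_le.1 d4
  -- collect the `u²`-sums into `2E`, `2E′`
  set n1 := Complex.normSq (1 - zPh L k (ex L))
  set n2 := Complex.normSq (1 - zPh L k (-ex L))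
  set n3 := Complex.normSq (1 - zPh L k (ey L))
  set n4 := Complex.normSq (1 - zPh L k (-ey L))
  set p1 := Complex.normSq (1 - zPh L (k + K1 L) (ex L))
  set p2 := Complex.normSq (1 - zPh L (k + K1 L) (-ex L))
  set p3 := Complex.normSq (1 - zPh L (k + K1 L) (ey L))
  set p4 := Complex.normSq (1 - zPh L (k + K1 L) (-ey L))
  set g0 := gres L lam2 k
  set g1 := gres L lam2 (k + K1 L)
  set β0 := betaK L Δ lam2 f k
  set β1 := betaK L Δ lam2 f (k + K1 L)
  set q := qPar L Δ f
  set τ := tauBar L Δ lam2 f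
  have hC : 0 ≤ β0 * (κ' * g1) / 4 + β1 * (κ' * g0) / 4 + κ' * g0 * (κ' * g1) / 8 := by
    obtain ⟨_, _, _, hβ, hg, _⟩ := regime_signs L hL hΔ0 hΔ1 hf k
    obtain ⟨_, _, _, hβ', hg', _⟩ := regime_signs L hL hΔ0 hΔ1 hf (k + K1 L)
    have ht := tail_slope_abs L hL hΔ0 hΔ1 hf M2 hM k hk hfloor
    have ht' := tail_slope_abs L hL hΔ0 hΔ1 hf M2 hM (k + K1 L) hk' hfloor'
    rw [← hκ] at ht ht'
    have hK0 : 0 ≤ κ' * g0 := (abs_nonneg _).trans ht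
    have hK0' : 0 ≤ κ' * g1 := (abs_nonneg _).trans ht'
    positivity
  -- the total of the four per-direction bounds equals `D₁`
  have htot : (n1 + p1) * (β0 * (κ' * g1) / 4 + β1 * (κ' * g0) / 4 + κ' * g0 * (κ' * g1) / 8)
        + τ * (n1 * β0 ^ 2 / (4 * m0) + m0 / 4) + τ * (p1 * β1 ^ 2 / (4 * m0) + m0 / 4)
        + q * (κ' * g1) + q * (κ' * g0) + q * τ + κ' * g0 * τ / 2 + κ' * g1 * τ / 2 + τ ^ 2 / 4
      + ((n2 + p2) * (β0 * (κ' * g1) / 4 + β1 * (κ' * g0) / 4 + κ' * g0 * (κ' * g1) / 8)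
        + τ * (n2 * β0 ^ 2 / (4 * m0) + m0 / 4) + τ * (p2 * β1 ^ 2 / (4 * m0) + m0 / 4)
        + q * (κ' * g1) + q * (κ' * g0) + q * τ + κ' * g0 * τ / 2 + κ' * g1 * τ / 2 + τ ^ 2 / 4)
      + ((n3 + p3) * (β0 * (κ' * g1) / 4 + β1 * (κ' * g0) / 4 + κ' * g0 * (κ' * g1) / 8)
        + τ * (n3 * β0 ^ 2 / (4 * m0) + m0 / 4) + τ * (p3 * β1 ^ 2 / (4 * m0) + m0 / 4)
        + q * (κ' * g1) + q * (κ' * g0) + q * τ + κ' * g0 * τ / 2 + κ' * g1 * τ / 2 + τ ^ 2 / 4)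
      + ((n4 + p4) * (β0 * (κ' * g1) / 4 + β1 * (κ' * g0) / 4 + κ' * g0 * (κ' * g1) / 8)
        + τ * (n4 * β0 ^ 2 / (4 * m0) + m0 / 4) + τ * (p4 * β1 ^ 2 / (4 * m0) + m0 / 4)
        + q * (κ' * g1) + q * (κ' * g0) + q * τ + κ' * g0 * τ / 2 + κ' * g1 * τ / 2 + τ ^ 2 / 4)
      = κ' / 2 * β0 * g1 * (EK L k + EK L (k + K1 L)) + τ * (β0 ^ 2 * EK L k / (2 * m0) + m0)
        + κ' / 2 * β1 * g0 * (EK L k + EK L (k + K1 L)) + τ * (β1 ^ 2 * EK L (k + K1 L) / (2 * m0) + m0)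
        + 4 * q * τ + τ ^ 2 + (4 * q * κ' + 2 * τ * κ') * (g0 + g1)
        + κ' ^ 2 / 4 * g0 * g1 * (EK L k + EK L (k + K1 L)) := by
    have e1 : EK L k = (n1 + n2 + n3 + n4) / 2 := by rw [hE]; ring
    have e2 : EK L (k + K1 L) = (p1 + p2 + p3 + p4) / 2 := by rw [hE']; ring
    rw [e1, e2]
    field_simp
    ring
  rw [← htot]
  have e : (((starRingEnd ℂ) (phiHat L f (ex L) k) * phiHat L f (ex L) (k + K1 L)).re
        + ((starRingEnd ℂ) (phiHat L f (-ex L) k) * phiHat L f (-ex L) (k + K1 L)).re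
        + ((starRingEnd ℂ) (phiHat L f (ey L) k) * phiHat L f (ey L) (k + K1 L)).re
        + ((starRingEnd ℂ) (phiHat L f (-ey L) k) * phiHat L f (-ey L) (k + K1 L)).re)
      - (((starRingEnd ℂ) (muK L Δ lam2 f (ex L) k) * muK L Δ lam2 f (ex L) (k + K1 L)).re
        + ((starRingEnd ℂ) (muK L Δ lam2 f (-ex L) k) * muK L Δ lam2 f (-ex L) (k + K1 L)).re
        + ((starRingEnd ℂ) (muK L Δ lam2 f (ey L) k) * muK L Δ lam2 f (ey L) (k + K1 L)).re
        + ((starRingEnd ℂ) (muK L Δ lam2 f (-ey L) k) * muK L Δ lam2 f (-ey L) (k + K1 L)).re)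
      = ((((starRingEnd ℂ) (phiHat L f (ex L) k) * phiHat L f (ex L) (k + K1 L)).re
          - ((starRingEnd ℂ) (muK L Δ lam2 f (ex L) k) * muK L Δ lam2 f (ex L) (k + K1 L)).re)
        + (((starRingEnd ℂ) (phiHat L f (-ex L) k) * phiHat L f (-ex L) (k + K1 L)).re
          - ((starRingEnd ℂ) (muK L Δ lam2 f (-ex L) k) * muK L Δ lam2 f (-ex L) (k + K1 L)).re)
        + (((starRingEnd ℂ) (phiHat L f (ey L) k) * phiHat L f (ey L) (k + K1 L)).re
          - ((starRingEnd ℂ) (muK L Δ lam2 f (ey L) k) * muK L Δ lam2 f (ey L) (k + K1 L)).re))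
        + (((starRingEnd ℂ) (phiHat L f (-ey L) k) * phiHat L f (-ey L) (k + K1 L)).re
          - ((starRingEnd ℂ) (muK L Δ lam2 f (-ey L) k) * muK L Δ lam2 f (-ey L) (k + K1 L)).re) := by ring
  rw [e]
  exact abs_le.2 ⟨by linarith only [l1, l2, l3, l4], by linarith only [r1, r2, r3, r4]⟩

/-- ★ per momentum off the pair block: `|Σ_e bcSummand − [R(c + c′) + M c′]| ≤ Rabs κ̂′(g+g′) + D₁ Z + M κ̂′ g′ + (Y+P₂) Z′`
(notation of `BCOuterBound` with `κ̂′ = kapHat + 2·aPar·cS/V`). [folklore] -/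
theorem bc_term_bound (hL : 5 ≤ L) {Δ : ℝ} (hΔ0 : 0 ≤ Δ) (hΔ1 : Δ < 1) {lam2 : ℝ} {f : Tor L → ℝ}
    (hf : IsGroundTwoMagnon L Δ lam2 f) (M2 : ℕ) (hM : 4 * (M2 + 2) ≤ L) {m0 : ℝ} (hm0 : 0 < m0)
    (k : Tor L) (hk : k ≠ 0) (hk' : k + K1 L ≠ 0)
    (hfloor : 1 - Real.cos (2 * Real.pi * (M2 + 1) / L) ≤ epsT L k)
    (hfloor' : 1 - Real.cos (2 * Real.pi * (M2 + 1) / L) ≤ epsT L (k + K1 L)) :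
    let g := gres L lam2
    let ac : Tor L → ℝ := fun k => 2 * cS L Δ lam2 f * g k + dPar L Δ f
    let κ := kapHat L Δ lam2 f M2 + 2 * aPar L Δ f * cS L Δ lam2 f / (L : ℝ) ^ 2
    let τ := tauBar L Δ lam2 f
    let q := qPar L Δ f
    let β := betaK L Δ lam2 f
    let E := EK L
    let k1 := K1 L
    let Y : Tor L → ℝ := fun k =>
      2 * β k * κ * g k * E k + τ * (β k ^ 2 * E k / m0 + 2 * m0) + 8 * q * κ * g k + 4 * q * τ
    let P2 : Tor L → ℝ := fun k => E k * κ ^ 2 * g k ^ 2 + 2 * τ ^ 2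
    let Rabs : Tor L → ℝ := fun k =>
      β k * β (k + k1) * (E k + E (k + k1) + 2 * eps1 L)
        + q / 2 * (β k + β (k + k1)) * (2 * eps1 L + E k + E (k + k1)) + 4 * q ^ 2
    let Z : Tor L → ℝ := fun k => ac k + ac (k + k1) + κ * (g k + g (k + k1))
    let Z' : Tor L → ℝ := fun k => ac (k + k1) + κ * g (k + k1)
    let D1 : Tor L → ℝ := fun k =>
      κ / 2 * β k * g (k + k1) * (E k + E (k + k1)) + τ * (β k ^ 2 * E k / (2 * m0) + m0)
        + κ / 2 * β (k + k1) * g k * (E k + E (k + k1)) + τ * (β (k + k1) ^ 2 * E (k + k1) / (2 * m0) + m0)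
        + 4 * q * τ + τ ^ 2 + (4 * q * κ + 2 * τ * κ) * (g k + g (k + k1))
        + κ ^ 2 / 4 * g k * g (k + k1) * (E k + E (k + k1))
    |((nnList L).map (fun e => bcSummand L f e k)).sum
        - (RK L Δ lam2 f k * (cK L Δ lam2 f k + cK L Δ lam2 f (k + k1)) + MK L Δ lam2 f k * cK L Δ lam2 f (k + k1))|
      ≤ Rabs k * κ * (g k + g (k + k1)) + D1 k * Z k + MK L Δ lam2 f k * κ * g (k + k1) + (Y k + P2 k) * Z' k := by
  dsimp only
  have h0 : 0 < lam2 := lam2_pos L (by omega) hΔ1 hf.1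
  set κ' := kapHat L Δ lam2 f M2 + 2 * aPar L Δ f * cS L Δ lam2 f / (L : ℝ) ^ 2 with hκ
  have ht := tail_slope_abs L hL hΔ0 hΔ1 hf M2 hM k hk hfloor
  have ht' := tail_slope_abs L hL hΔ0 hΔ1 hf M2 hM (k + K1 L) hk' hfloor'
  rw [← hκ] at ht ht'
  have hF2 := (f2ClosedPlusTail_holds L hL hΔ0 lam2 f hf h0).2 k hk
  have hF2' := (f2ClosedPlusTail_holds L hL hΔ0 lam2 f hf h0).2 (k + K1 L) hk'
  have hMK := mKIdentity_holds L Δ lam2 f k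
  have hMnn : 0 ≤ MK L Δ lam2 f k := by
    rw [← hMK, nnList_map_sum]
    exact add_nonneg (add_nonneg (add_nonneg (Complex.normSq_nonneg _) (Complex.normSq_nonneg _))
      (Complex.normSq_nonneg _)) (Complex.normSq_nonneg _)
  have hRabs := abs_RK_le L hL hΔ0 hΔ1 hf k
  have hSM := sum_normSq_diff_le L hL hΔ0 hΔ1 hf M2 hM hm0 k hk hfloor
  dsimp only at hSM
  rw [← hκ] at hSM
  have hX := cross_sum_diff_le L hL hΔ0 hΔ1 hf M2 hM hm0 k hk hk' hfloor hfloor'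
  dsimp only at hX
  rw [← hκ] at hX
  have hc_abs := abs_cK_eq L hL hΔ0 hΔ1 hf k
  have hc_abs' := abs_cK_eq L hL hΔ0 hΔ1 hf (k + K1 L)
  -- factor bounds
  have hZ : |cK L Δ lam2 f k + cK L Δ lam2 f (k + K1 L) + tfun L Δ f k + tfun L Δ f (k + K1 L)|
      ≤ (2 * cS L Δ lam2 f * gres L lam2 k + dPar L Δ f) + (2 * cS L Δ lam2 f * gres L lam2 (k + K1 L) + dPar L Δ f)
        + κ' * (gres L lam2 k + gres L lam2 (k + K1 L)) := by
    have h1 := abs_add_le (cK L Δ lam2 f k + cK L Δ lam2 f (k + K1 L) + tfun L Δ f k) (tfun L Δ f (k + K1 L))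
    have h2 := abs_add_le (cK L Δ lam2 f k + cK L Δ lam2 f (k + K1 L)) (tfun L Δ f k)
    have h3 := abs_add_le (cK L Δ lam2 f k) (cK L Δ lam2 f (k + K1 L))
    linarith only [h1, h2, h3, hc_abs.le, hc_abs.ge, hc_abs'.le, hc_abs'.ge, ht, ht']
  have hZ' : |cK L Δ lam2 f (k + K1 L) + tfun L Δ f (k + K1 L)|
      ≤ (2 * cS L Δ lam2 f * gres L lam2 (k + K1 L) + dPar L Δ f) + κ' * gres L lam2 (k + K1 L) := by
    have h1 := abs_add_le (cK L Δ lam2 f (k + K1 L)) (tfun L Δ f (k + K1 L))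
    linarith only [h1, hc_abs'.le, hc_abs'.ge, ht']
  have htt : |tfun L Δ f k + tfun L Δ f (k + K1 L)| ≤ κ' * (gres L lam2 k + gres L lam2 (k + K1 L)) := by
    have h1 := abs_add_le (tfun L Δ f k) (tfun L Δ f (k + K1 L))
    linarith only [h1, ht, ht']
  -- decomposition
  rw [nnList_map_sum]
  have edec : bcSummand L f (ex L) k + bcSummand L f (-ex L) k + bcSummand L f (ey L) k + bcSummand L f (-ey L) k
        - (RK L Δ lam2 f k * (cK L Δ lam2 f k + cK L Δ lam2 f (k + K1 L)) + MK L Δ lam2 f k * cK L Δ lam2 f (k + K1 L))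
      = ((((starRingEnd ℂ) (phiHat L f (ex L) k) * phiHat L f (ex L) (k + K1 L)).re
            + ((starRingEnd ℂ) (phiHat L f (-ex L) k) * phiHat L f (-ex L) (k + K1 L)).re
            + ((starRingEnd ℂ) (phiHat L f (ey L) k) * phiHat L f (ey L) (k + K1 L)).re
            + ((starRingEnd ℂ) (phiHat L f (-ey L) k) * phiHat L f (-ey L) (k + K1 L)).re) - RK L Δ lam2 f k)
          * (cK L Δ lam2 f k + cK L Δ lam2 f (k + K1 L) + tfun L Δ f k + tfun L Δ f (k + K1 L))
        + RK L Δ lam2 f k * (tfun L Δ f k + tfun L Δ f (k + K1 L))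
        + (Complex.normSq (phiHat L f (ex L) k) + Complex.normSq (phiHat L f (-ex L) k)
            + Complex.normSq (phiHat L f (ey L) k) + Complex.normSq (phiHat L f (-ey L) k) - MK L Δ lam2 f k)
          * (cK L Δ lam2 f (k + K1 L) + tfun L Δ f (k + K1 L))
        + MK L Δ lam2 f k * tfun L Δ f (k + K1 L) := by
    unfold bcSummand
    rw [hF2, hF2']
    ring
  rw [edec]
  refine (bc_assembly hX hZ hRabs htt hSM hZ' hMnn ht').trans (le_of_eq ?_)
  ring

/-- ★ `B_C` OUTER MAJORANT (repaired slope): the sum over `outerP` of `bc_term_bound` — `BCOuterBound` with `κ̂′` for `κ̂`,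
in the regime (`L ≥ 5`, `0 ≤ Δ < 1`, ground state, `4(M₂+2) ≤ L`, `m₀ > 0`). [folklore] -/
theorem bc_outer_bound (hL : 5 ≤ L) {Δ : ℝ} (hΔ0 : 0 ≤ Δ) (hΔ1 : Δ < 1) {lam2 : ℝ} {f : Tor L → ℝ}
    (hf : IsGroundTwoMagnon L Δ lam2 f) (M2 : ℕ) (hM : 4 * (M2 + 2) ≤ L) {m0 : ℝ} (hm0 : 0 < m0) :
    let g := gres L lam2
    let ac : Tor L → ℝ := fun k => 2 * cS L Δ lam2 f * g k + dPar L Δ f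
    let κ := kapHat L Δ lam2 f M2 + 2 * aPar L Δ f * cS L Δ lam2 f / (L : ℝ) ^ 2
    let τ := tauBar L Δ lam2 f
    let q := qPar L Δ f
    let β := betaK L Δ lam2 f
    let E := EK L
    let k1 := K1 L
    let Y : Tor L → ℝ := fun k =>
      2 * β k * κ * g k * E k + τ * (β k ^ 2 * E k / m0 + 2 * m0) + 8 * q * κ * g k + 4 * q * τ
    let P2 : Tor L → ℝ := fun k => E k * κ ^ 2 * g k ^ 2 + 2 * τ ^ 2
    let Rabs : Tor L → ℝ := fun k =>
      β k * β (k + k1) * (E k + E (k + k1) + 2 * eps1 L)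
        + q / 2 * (β k + β (k + k1)) * (2 * eps1 L + E k + E (k + k1)) + 4 * q ^ 2
    let Z : Tor L → ℝ := fun k => ac k + ac (k + k1) + κ * (g k + g (k + k1))
    let Z' : Tor L → ℝ := fun k => ac (k + k1) + κ * g (k + k1)
    let D1 : Tor L → ℝ := fun k =>
      κ / 2 * β k * g (k + k1) * (E k + E (k + k1)) + τ * (β k ^ 2 * E k / (2 * m0) + m0)
        + κ / 2 * β (k + k1) * g k * (E k + E (k + k1)) + τ * (β (k + k1) ^ 2 * E (k + k1) / (2 * m0) + m0)
        + 4 * q * τ + τ ^ 2 + (4 * q * κ + 2 * τ * κ) * (g k + g (k + k1))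
        + κ ^ 2 / 4 * g k * g (k + k1) * (E k + E (k + k1))
    |∑ k ∈ outerP L M2, (((nnList L).map (fun e => bcSummand L f e k)).sum
        - (RK L Δ lam2 f k * (cK L Δ lam2 f k + cK L Δ lam2 f (k + k1)) + MK L Δ lam2 f k * cK L Δ lam2 f (k + k1)))|
      ≤ ∑ k ∈ outerP L M2,
          (Rabs k * κ * (g k + g (k + k1)) + D1 k * Z k + MK L Δ lam2 f k * κ * g (k + k1) + (Y k + P2 k) * Z' k) := by
  dsimp only
  have hfl := ((outerEnergyFloor_holds L M2) hM).1
  refine (Finset.abs_sum_le_sum_abs _ _).trans (Finset.sum_le_sum fun k hk => ?_)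
  have hkT : k ∈ torPrime L := by
    unfold outerP at hk
    exact (Finset.mem_filter.1 hk).1
  have hk0 : k ≠ 0 ∧ k + K1 L ≠ 0 := by
    unfold torPrime at hkT
    exact (Finset.mem_filter.1 hkT).2
  obtain ⟨h1, h2⟩ := hfl k hk
  exact bc_term_bound L hL hΔ0 hΔ1 hf M2 hM hm0 k hk0.1 hk0.2 h1 h2

end OuterMaj

end Summit.HubbardSuperconductivity.HubbardSuperconductivity.Theorems.AnisotropyChord.Transfer.Fibre3

end
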